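import Summits.NavierStokesRegularity.NavierStokesRegularity.Theses.AdaptedFrequency

/-!
# Route AdaptedFrequency — `Assembly` (item stmt-NavierStokesRegularity-2960)

Pure logic: the route statements of `AdaptedFrequency`, in the antecedent order

  `AdaptedFrequencyConverges → FrequencyRigidity → TangentFlowTransfer → AdaptedKernelExists →
   SingularPointExists → NoTypeII → NoBlowupToClay → NavierStokesRegularity`,

imply Clay (A). This is, hypothesis for hypothesis, the route's deciding theorem
`Summit.NavierStokesRegularity.NavierStokesRegularity.Theses.AdaptedFrequency.closes`; the proof
below is self-contained (it does not invoke `closes`), so that it depends only on the item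
definitions.

Argument. `NoBlowupToClay` reduces `NavierStokesRegularity` to: every finite-energy (Leray–Hopf)
classical solution on `ℝ³ × [0,T)` from a rapidly decaying datum extends smoothly past `T`. Suppose
one does not. Then it is maximal (`IsMaximalSmoothSolution = classical ∧ ¬ HasSmoothExtensionPast`,
definitional), so `NoTypeII` gives the Type-I rate and `SingularPointExists` a backward-singular
point `x₀`; `AdaptedKernelExists` gives `t₀, G` adapted and Gaussian-comparable at `(T, x₀)`;
`AdaptedFrequencyConverges` gives `Λ₀` with `Λ → Λ₀` (the `∀ H Λ` binders instantiated by
`rfl, rfl`); `TangentFlowTransfer` produces `(C, v, q, K)` satisfying exactly the `∃`-body of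
`FrequencyRigidity` with `(ν, C, Λ₀)`; `FrequencyRigidity` is `¬ ∃` of that body: contradiction.
Nothing here is new mathematics; the open content lives in the cruxes.
-/

namespace Summit.NavierStokesRegularity.NavierStokesRegularity.Theorems

open Summit.NavierStokesRegularity.NavierStokesRegularity.Theses.AdaptedFrequency

/-- **Assembly** (item stmt-NavierStokesRegularity-2960, route AdaptedFrequency):
`AdaptedFrequencyConverges → FrequencyRigidity → TangentFlowTransfer → AdaptedKernelExists →
SingularPointExists → NoTypeII → NoBlowupToClay → NavierStokesRegularity` — pure logic:
`NoBlowupToClay` reduces Clay (A) to continuation past every `T`; a non-extendable solution is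
maximal, hence Type I (`NoTypeII`) with a backward-singular point (`SingularPointExists`), an
adapted comparable kernel there (`AdaptedKernelExists`), a convergent adapted frequency
(`AdaptedFrequencyConverges`) and a tangent flow with constant adapted frequency
(`TangentFlowTransfer`), which `FrequencyRigidity` excludes. [folklore] -/
theorem adaptedFrequency_assembly_proof :
    Summit.NavierStokesRegularity.NavierStokesRegularity.Theses.AdaptedFrequency.Assembly := by
  unfold Assembly
  intro hAFC hFR hTFT hAKE hSPE hNT2 hNBC
  refine hNBC ?_
  intro ν T hν hT u p hcl hLH hdec
  by_contra hne
  have hmax : Literature.Analysis.FluidPDE.IsMaximalSmoothSolution ν 0 u p T := ⟨hcl, hne⟩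
  have hTI : Literature.Analysis.FluidPDE.IsTypeIBlowup u T := hNT2 ν T hν hT u p hmax hLH hdec
  obtain ⟨x₀, hsing⟩ := hSPE ν T hν hT u p hmax hLH hdec
  obtain ⟨t₀, ht₀, G, hK, hcomp⟩ := hAKE ν T hν hT u p hcl hLH hdec hTI x₀
  obtain ⟨Λ₀, hlim⟩ := hAFC ν T hν hT u p hcl hLH hdec hTI x₀ t₀ G ht₀ hsing hK hcomp _ _ rfl rfl
  obtain ⟨C, v, q, K, hbody⟩ :=
    hTFT ν T hν hT u p hcl hLH hdec hTI x₀ t₀ G ht₀ hsing hK hcomp _ _ rfl rfl Λ₀ hlim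
  exact hFR ⟨ν, C, Λ₀, v, q, K, hν, hbody⟩

end Summit.NavierStokesRegularity.NavierStokesRegularity.Theorems
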